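import Summits.MatrixMultiplication.OmegaCensus.SmallFormats.GF2FastLB
import Summits.MatrixMultiplication.OmegaCensus.SmallFormats.GF2FastSandwich
import HarnessLib

/-!
# ω-census family (a), GF(2) rank floors: FAST replay of LP-DFS rounds, part 2 (lookup-table validation)

Cell `pub-mm22` (MatrixMultiplication venture, Route D3-STRETCH `20 ≤ R_𝔽₂(⟨3,3,3⟩)`, seat p3 g3), topic
`Summits/MatrixMultiplication/OmegaCensus` (sub-folder `SmallFormats`). HONEST FRAMING: checker PLUMBING, PROVED (0 sorry);
no bound is claimed here and nothing is progress on `ω`.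

The pull-back table validation `fastTableOK` / `fastTableTOK` (`GF2FastSandwich.lean`) spends almost all of its kernel time
in `Nat.testBit` (bit-matrix products `mulBits`, transposes `trBits`, reductions `reduceB`, `extraOf`), whose unfolding
through `HAnd`/`HShiftRight`/`bne`/`BEq`/`Nat.decEq` costs ~0.5 ms per call in the kernel (measured). This file gives
twins of these functions written with `bitB` (`GF2FastLB.lean`: `Nat.shiftRight`/`Nat.land`/`Nat.beq`, all
kernel-accelerated) — `mulBitsF`, `trBitsF`, `topBitF`, `reduceBF`, `extraOfF`, `sandFBF`, `sandTFBF` — proves them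
EQUAL to the landed ones, and derives the landed table checks from row-wise facts read through 64-blocks
(`fastTableOK_of_rows`, `fastTableTOK_of_rows`) and from parts (`fastTableOK_append`, `fastTableTOK_append`).
-/

namespace Summit.MatrixMultiplication.OmegaCensus.GF2RankLB

open Literature.Computability.AlgebraicComplexity

/-! ## `bitB` twins of the bit-matrix primitives -/

/-- `mulBits` with `bitB`. -/
def mulBitsF (l m n : ℕ) (x y : ℕ) : ℕ :=
  maskOf (fun p => bxor (fun a => bitB x (pos m (p / n) a) && bitB y (pos n a (p % n))) m) (l * n)

/-- `mulBitsF = mulBits`. -/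
theorem mulBitsF_eq (l m n x y : ℕ) : mulBitsF l m n x y = mulBits l m n x y := by
  simp only [mulBitsF, mulBits, bitB_eq_testBit]

/-- `trBits` with `bitB`. -/
def trBitsF (l m : ℕ) (x : ℕ) : ℕ := maskOf (fun p => bitB x (pos m (p % l) (p / l))) (m * l)

/-- `trBitsF = trBits`. -/
theorem trBitsF_eq (l m x : ℕ) : trBitsF l m x = trBits l m x := by
  simp only [trBitsF, trBits, bitB_eq_testBit]

/-- `topBit` with `bitB`. -/
def topBitF (κ : ℕ) : ℕ → ℕ
  | 0 => 0
  | p + 1 => bif bitB κ p then p else topBitF κ p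

/-- `topBitF = topBit`. -/
theorem topBitF_eq (κ : ℕ) : ∀ p, topBitF κ p = topBit κ p
  | 0 => rfl
  | p + 1 => by
    rw [topBitF, topBit, topBitF_eq κ p, bitB_eq_testBit]
    cases κ.testBit p <;> rfl

/-- `reduceB` with `bitB`. -/
def reduceBF : List ℕ → ℕ → ℕ
  | [], g => g
  | κ :: K, g => reduceBF K (bif bitB g (topBitF κ 16) then Nat.xor g κ else g)

/-- `reduceBF = reduceB`. -/
theorem reduceBF_eq : ∀ (K : List ℕ) (g : ℕ), reduceBF K g = reduceB K g
  | [], _ => rfl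
  | κ :: K, g => by
    rw [reduceBF, reduceB, topBitF_eq, bitB_eq_testBit, reduceBF_eq K]
    cases g.testBit (topBit κ 16) <;> rfl

/-- Worker of `extraOfF`: the candidates at the set bit positions, scanning `cands` once. -/
def extraGo (fm : ℕ) (cands : List ℕ) : List ℕ → ℕ → List ℕ
  | [], _ => []
  | c :: cs, i => bif bitB fm i then c :: extraGo fm cands cs (i + 1) else extraGo fm cands cs (i + 1)

/-- `extraOf` with one scan and `bitB`. -/
def extraOfF (cands : List ℕ) (fm : ℕ) : List ℕ := extraGo fm cands cands 0

/-- The worker agrees with the `range'`/`filter`/`map` description on every suffix. -/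
theorem extraGo_eq (fm : ℕ) (cands : List ℕ) : ∀ (cs : List ℕ) (k : ℕ), cands.drop k = cs →
    extraGo fm cands cs k = ((List.range' k cs.length).filter fun i => fm.testBit i).map fun i => cands.getD i 0
  | [], k, _ => by simp [extraGo]
  | c :: cs, k, hd => by
    have hc : cands[k]?.getD 0 = c := by
      have h0 : (cands.drop k)[0]? = cands[k + 0]? := List.getElem?_drop
      rw [hd, Nat.add_zero] at h0
      rw [← h0]
      rfl
    have hd' : cands.drop (k + 1) = cs := by rw [← List.tail_drop, hd, List.tail_cons]
    rw [extraGo, List.length_cons, List.range'_succ, List.filter_cons, extraGo_eq fm cands cs (k + 1) hd',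
      bitB_eq_testBit]
    cases fm.testBit k
    · simp
    · simp [hc]

/-- `extraOfF = extraOf`. -/
theorem extraOfF_eq (cands : List ℕ) (fm : ℕ) : extraOfF cands fm = extraOf cands fm := by
  rw [extraOfF, extraGo_eq fm cands cands 0 (List.drop_zero), extraOf, List.range_eq_range']

/-! ## Fast sandwich checks -/

/-- `pullB` with the twins. -/
def pullBF (l m P Q κ : ℕ) : ℕ := mulBitsF l l m (trBitsF l l P) (mulBitsF l m m κ (trBitsF m m Q))

/-- `pullBF = pullB`. -/
theorem pullBF_eq (l m P Q κ : ℕ) : pullBF l m P Q κ = pullB l m P Q κ := by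
  simp only [pullBF, pullB, mulBitsF_eq, trBitsF_eq]

/-- `pullTB` with the twins. -/
def pullTBF (l P Q κ : ℕ) : ℕ := mulBitsF l l l Q (mulBitsF l l l (trBitsF l l κ) P)

/-- `pullTBF = pullTB`. -/
theorem pullTBF_eq (l P Q κ : ℕ) : pullTBF l P Q κ = pullTB l P Q κ := by
  simp only [pullTBF, pullTB, mulBitsF_eq, trBitsF_eq]

/-- `Nat.beq` is `==`. -/
theorem natBeq_eq (a b : ℕ) : Nat.beq a b = (a == b) := by
  rw [Bool.eq_iff_iff, Nat.beq_eq, beq_iff_eq]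

/-- FAST plain sandwich check (same value as `sandFB`). -/
def sandFBF (l m : ℕ) (Kr Kt : List ℕ) (P Pi Q Qi : ℕ) : Bool :=
  Nat.beq (mulBitsF l l l Pi P) (oneBits l) && Nat.beq (mulBitsF m m m Q Qi) (oneBits m) &&
    Kt.all fun κ => Nat.beq (reduceBF Kr (pullBF l m P Q κ)) 0

/-- `sandFBF = sandFB`. -/
theorem sandFBF_eq (l m : ℕ) (Kr Kt : List ℕ) (P Pi Q Qi : ℕ) :
    sandFBF l m Kr Kt P Pi Q Qi = sandFB l m Kr Kt P Pi Q Qi := by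
  simp only [sandFBF, sandFB, natBeq_eq, mulBitsF_eq, reduceBF_eq, pullBF_eq]

/-- FAST transposed sandwich check (same value as `sandTFB`). -/
def sandTFBF (l : ℕ) (Kr Kt : List ℕ) (P Pi Q Qi : ℕ) : Bool :=
  Nat.beq (mulBitsF l l l Pi P) (oneBits l) && Nat.beq (mulBitsF l l l Q Qi) (oneBits l) &&
    Kt.all fun κ => Nat.beq (reduceBF Kr (pullTBF l P Q κ)) 0

/-- `sandTFBF = sandTFB`. -/
theorem sandTFBF_eq (l : ℕ) (Kr Kt : List ℕ) (P Pi Q Qi : ℕ) :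
    sandTFBF l Kr Kt P Pi Q Qi = sandTFB l Kr Kt P Pi Q Qi := by
  simp only [sandTFBF, sandTFB, natBeq_eq, mulBitsF_eq, reduceBF_eq, pullTBF_eq]

/-! ## Row-wise table validation -/

/-- One row of a plain lookup table passes the (fast) validation. -/
def fastEntryOK (l m : ℕ) (os : List Orbit) (i : ℕ) (K cands : List ℕ) (e : LookRow) : Bool :=
  Nat.blt e.2.1 i && sandFBF l m (kOf os e.2.1) (K ++ extraOfF cands e.1) e.2.2.1 e.2.2.2.1 e.2.2.2.2.1 e.2.2.2.2.2

/-- One row of a transposed lookup table passes the (fast) validation. -/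
def fastEntryTOK (l : ℕ) (os : List Orbit) (i : ℕ) (K cands : List ℕ) (e : LookRow) : Bool :=
  Nat.blt e.2.1 i && sandTFBF l (kOf os e.2.1) (K ++ extraOfF cands e.1) e.2.2.1 e.2.2.2.1 e.2.2.2.2.1 e.2.2.2.2.2

/-- Row `k` read through 64-blocks is row `k`. -/
theorem getC?_getD_eq (t : List LookRow) (k : ℕ) : (getC? t 64 k).getD default = t.getD k default := by
  rw [getC?_eq _ (by decide), List.getD_eq_getElem?_getD]

/-- **Row-wise plain table validation**: facts about every row (read through 64-blocks) give `fastTableOK`. -/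
theorem fastTableOK_of_rows {l m : ℕ} {os : List Orbit} {i : ℕ} {K cands : List ℕ} {table : List LookRow}
    (h : ∀ k < table.length, fastEntryOK l m os i K cands ((getC? table 64 k).getD default) = true) :
    fastTableOK l m os i K cands table = true := by
  rw [fastTableOK, List.all_eq_true]
  intro e he
  obtain ⟨k, hk, rfl⟩ := List.getElem_of_mem he
  have h1 := h k hk
  rw [getC?_getD_eq, List.getD_eq_getElem _ _ hk, fastEntryOK, Bool.and_eq_true, Nat.blt_eq, sandFBF_eq,
    extraOfF_eq] at h1
  rw [Bool.and_eq_true, decide_eq_true_eq]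
  exact h1

/-- **Row-wise transposed table validation.** -/
theorem fastTableTOK_of_rows {l : ℕ} {os : List Orbit} {i : ℕ} {K cands : List ℕ} {tableT : List LookRow}
    (h : ∀ k < tableT.length, fastEntryTOK l os i K cands ((getC? tableT 64 k).getD default) = true) :
    fastTableTOK l os i K cands tableT = true := by
  rw [fastTableTOK, List.all_eq_true]
  intro e he
  obtain ⟨k, hk, rfl⟩ := List.getElem_of_mem he
  have h1 := h k hk
  rw [getC?_getD_eq, List.getD_eq_getElem _ _ hk, fastEntryTOK, Bool.and_eq_true, Nat.blt_eq, sandTFBF_eq,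
    extraOfF_eq] at h1
  rw [Bool.and_eq_true, decide_eq_true_eq]
  exact h1

/-- Plain table validation of a concatenation. -/
theorem fastTableOK_append {l m : ℕ} {os : List Orbit} {i : ℕ} {K cands : List ℕ} {t₁ t₂ : List LookRow}
    (h₁ : fastTableOK l m os i K cands t₁ = true) (h₂ : fastTableOK l m os i K cands t₂ = true) :
    fastTableOK l m os i K cands (t₁ ++ t₂) = true := by
  rw [fastTableOK, List.all_append, Bool.and_eq_true]
  exact ⟨h₁, h₂⟩

/-- Transposed table validation of a concatenation. -/
theorem fastTableTOK_append {l : ℕ} {os : List Orbit} {i : ℕ} {K cands : List ℕ} {t₁ t₂ : List LookRow}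
    (h₁ : fastTableTOK l os i K cands t₁ = true) (h₂ : fastTableTOK l os i K cands t₂ = true) :
    fastTableTOK l os i K cands (t₁ ++ t₂) = true := by
  rw [fastTableTOK, List.all_append, Bool.and_eq_true]
  exact ⟨h₁, h₂⟩

end Summit.MatrixMultiplication.OmegaCensus.GF2RankLB
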